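import Summits.CriticalPhenomena.SAWScalingLimit.Theorems.SAWLeftRightFKGLeftRightFKGStubCornerAssemblyAlgebra
import Summits.CriticalPhenomena.SAWScalingLimit.Theorems.SAWLeftRightFKGLeftRightFKGStubCornerAssemblyClass
import Summits.CriticalPhenomena.SAWScalingLimit.Theorems.SAWLeftRightFKGLeftRightFKGStubCornerAssemblyKernel
import Summits.CriticalPhenomena.SAWScalingLimit.Theorems.SAWLeftRightFKGLeftRightFKGStubEndpointMonotoneAux
import Summits.CriticalPhenomena.SAWScalingLimit.Theorems.SAWLeftRightFKGLeftRightFKGStubStepMonotone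
import Summits.CriticalPhenomena.SAWScalingLimit.Theorems.SAWLeftRightFKGLeftRightFKGStubMeshReduction
import Summits.CriticalPhenomena.SAWScalingLimit.Theorems.SAWLeftRightFKGLeftRightFKGStubLoopWindVanish
import Summits.CriticalPhenomena.SAWScalingLimit.Theorems.SAWTotalPositivityBoundaryTP2Symmetry
import HarnessLib

/-!
# Stub `stub_cornerAssembly` of line `corner-localisation` (lead c1 reshape v5): the term inequality

Crux `LeftRightFKG` (stmt-CriticalPhenomena-11232). For one prefix/suffix class of a crux instance WITHOUT its direct
chord, the entries of the end-step matrix are path kernels of the free graph (helper file 3), and every crossed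
product of entries is at most the nested product (`term_le`): an INVERSION (an up-event containing a lower-ranked
direction but not a higher-ranked one, at either end) forces all chords of the two directions to meet (helper file
2), so the two rows/columns are proportional (`AllMeetProportionalAt`); a NORMAL term is an interlaced corner
quadruple of the free graph (helper files 2, 3), signed by `CornerQuadrupleTP2At`. The block inequality of the class
then follows from helper file 1 (`block_noDirect`).
-/

noncomputable section

open Finset SimpleGraph
open Literature.Probability.LatticeModels Literature.Probability.RandomPlanarGeometry
open scoped Classical ENNReal

namespace Summit.CriticalPhenomena.SAWScalingLimit.Theorems.LeftRightFKG.CornerLoc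

namespace CornerAssembly

section Term

variable {δ : ℝ} {c a b a' b' : Site 2} {C : (zdGraph 2).Walk c c} {k : ℕ} {π : ℕ → Site 2} {m : ℕ}
  {σ : ℕ → Site 2}

/-- Realised end-steps of a chord of length `≥ k + m + 2`: the next step is a free domain-neighbour of `π k`, the
previous step a free domain-neighbour of `σ m`. [folklore] -/
theorem free_adj_of_long {γ : SAW.DomainSAW (dom C δ) δ a b} (hγ : γ ∈ cls k π m σ) (hL : k + m + 2 ≤ γ.length) :
    γ.walk.getVert (k + 1) ∉ fixedSet k π m σ ∧ (discreteDomainGraph (dom C δ) δ).Adj (π k) (γ.walk.getVert (k + 1)) ∧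
    γ.walk.reverse.getVert (m + 1) ∉ fixedSet k π m σ ∧
      (discreteDomainGraph (dom C δ) δ).Adj (γ.walk.reverse.getVert (m + 1)) (σ m) :=
  ⟨next_not_mem_fixedSet hγ hL, adj_next hγ (by omega), prev_not_mem_fixedSet hγ hL, adj_prev hγ (by omega)⟩

/-- The two marked points of a class with a long chord are distinct. [folklore] -/
theorem marked_ne {γ : SAW.DomainSAW (dom C δ) δ a b} (hγ : γ ∈ cls k π m σ) (hL : k + m + 2 ≤ γ.length) :
    π k ≠ σ m := by
  obtain ⟨hγa, hγr⟩ : AgreeTo k π γ ∧ AgreeToR m σ γ := hγ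
  have e1 : γ.walk.getVert k = π k := hγa k le_rfl
  have e2 : γ.walk.getVert (γ.length - m) = σ m := by
    have := hγr m le_rfl; rwa [Walk.getVert_reverse] at this
  intro h
  have := getVert_inj γ (by omega) (by omega) (e1.trans (h.trans e2.symm))
  omega

/-- THE TERM INEQUALITY. Chords of one class of a crux instance, collected in a finite set `s` closed under
direction classes and containing no direct chord; entries `Z u w = Σ_{γ ∈ s, next γ = u, prev γ = w} x^{|γ|}`; row
event `pE` / column event `pF` induced by relative up-sets `A` (next-step determined) / `B` (previous-step
determined). Then `Z u w' · Z u' w ≤ Z u w · Z u' w'` for `pE u`, `¬ pE u'`, `pF w`, `¬ pF w'`. [folklore] -/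
theorem term_le {x : ℝ} (hx : 0 < x) (hD : ClassDictionaryAt (dom C δ) δ a b) (hP : AllMeetProportionalAt x)
    (hQ : CornerQuadrupleTP2At x) (hI : IsInst δ a b a' b' C) [Fintype (SAW.DomainSAW (dom C δ) δ a b)]
    {r r' : Site 2 → ℕ} (hrinj : Set.InjOn r ((zdGraph 2).neighborSet (π k)))
    (hr : ∀ γ₁ γ₂ : SAW.DomainSAW (dom C δ) δ a b, AgreeTo k π γ₁ → AgreeTo k π γ₂ → lr γ₁ γ₂ →
      r (γ₁.walk.getVert (k + 1)) ≤ r (γ₂.walk.getVert (k + 1)))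
    (hr'inj : Set.InjOn r' ((zdGraph 2).neighborSet (σ m)))
    (hr' : ∀ γ₁ γ₂ : SAW.DomainSAW (dom C δ) δ a b, AgreeToR m σ γ₁ → AgreeToR m σ γ₂ → lr γ₁ γ₂ →
      r' (γ₁.walk.reverse.getVert (m + 1)) ≤ r' (γ₂.walk.reverse.getVert (m + 1)))
    {A B : Set (SAW.DomainSAW (dom C δ) δ a b)} (hA : IsUpOn (cls k π m σ) A) (hB : IsUpOn (cls k π m σ) B)
    (hAn : NextDet k A) (hBp : PrevDet m B) (s : Finset (SAW.DomainSAW (dom C δ) δ a b))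
    (hs1 : ∀ γ ∈ s, γ ∈ cls k π m σ)
    (hs2 : ∀ γ : SAW.DomainSAW (dom C δ) δ a b, γ ∈ cls k π m σ →
      (∃ γ' ∈ s, γ'.walk.getVert (k + 1) = γ.walk.getVert (k + 1)) →
      (∃ γ'' ∈ s, γ''.walk.reverse.getVert (m + 1) = γ.walk.reverse.getVert (m + 1)) → γ ∈ s)
    (hnd : ∀ γ ∈ s, k + m + 2 ≤ γ.length)
    (h2 : ∃ γ₁ γ₂ : SAW.DomainSAW (dom C δ) δ a b, γ₁ ∈ cls k π m σ ∧ γ₂ ∈ cls k π m σ ∧ γ₁ ≠ γ₂)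
    {u u' w w' : Site 2} (hu : u ∈ s.image fun γ => γ.walk.getVert (k + 1))
    (hu' : u' ∈ s.image fun γ => γ.walk.getVert (k + 1))
    (hw : w ∈ s.image fun γ => γ.walk.reverse.getVert (m + 1))
    (hw' : w' ∈ s.image fun γ => γ.walk.reverse.getVert (m + 1))
    (hEu : ∃ γ ∈ s, γ.walk.getVert (k + 1) = u ∧ γ ∈ A) (hEu' : ¬ ∃ γ ∈ s, γ.walk.getVert (k + 1) = u' ∧ γ ∈ A)
    (hFw : ∃ γ ∈ s, γ.walk.reverse.getVert (m + 1) = w ∧ γ ∈ B)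
    (hFw' : ¬ ∃ γ ∈ s, γ.walk.reverse.getVert (m + 1) = w' ∧ γ ∈ B) :
    (∑ γ ∈ s.filter (fun γ => γ.walk.getVert (k + 1) = u ∧ γ.walk.reverse.getVert (m + 1) = w'), x ^ γ.length) *
      (∑ γ ∈ s.filter (fun γ => γ.walk.getVert (k + 1) = u' ∧ γ.walk.reverse.getVert (m + 1) = w), x ^ γ.length) ≤
    (∑ γ ∈ s.filter (fun γ => γ.walk.getVert (k + 1) = u ∧ γ.walk.reverse.getVert (m + 1) = w), x ^ γ.length) *
      (∑ γ ∈ s.filter (fun γ => γ.walk.getVert (k + 1) = u' ∧ γ.walk.reverse.getVert (m + 1) = w'),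
        x ^ γ.length) := by
  -- notation
  set G := discreteDomainGraph (dom C δ) δ with hG
  set H := freeGraph (dom C δ) δ k π m σ with hH
  have hfin : H.support.Finite := support_freeGraph_finite (isBounded_dom C δ) hI.1 k π m σ
  -- realised directions are free neighbours of the marked points
  obtain ⟨γu, hγu, rfl⟩ := mem_image.1 hu
  obtain ⟨γu', hγu', rfl⟩ := mem_image.1 hu'
  obtain ⟨γw, hγw, rfl⟩ := mem_image.1 hw
  obtain ⟨γw', hγw', rfl⟩ := mem_image.1 hw'
  obtain ⟨huf, hpu, -, -⟩ := free_adj_of_long (hs1 _ hγu) (hnd _ hγu)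
  obtain ⟨hu'f, hpu', -, -⟩ := free_adj_of_long (hs1 _ hγu') (hnd _ hγu')
  obtain ⟨-, -, hwf, hwq⟩ := free_adj_of_long (hs1 _ hγw) (hnd _ hγw)
  obtain ⟨-, -, hw'f, hw'q⟩ := free_adj_of_long (hs1 _ hγw') (hnd _ hγw')
  set u := γu.walk.getVert (k + 1) with hudef
  set u' := γu'.walk.getVert (k + 1) with hu'def
  set w := γw.walk.reverse.getVert (m + 1) with hwdef
  set w' := γw'.walk.reverse.getVert (m + 1) with hw'def
  -- membership in `A` / `B` by direction
  have hAu : ∀ γ : SAW.DomainSAW (dom C δ) δ a b, γ.walk.getVert (k + 1) = u → γ ∈ A := by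
    obtain ⟨γ₀, -, h₀, h₀A⟩ := hEu
    exact fun γ hγ => (hAn γ γ₀ (hγ.trans h₀.symm)).2 h₀A
  have hAu' : ∀ γ : SAW.DomainSAW (dom C δ) δ a b, γ.walk.getVert (k + 1) = u' → γ ∉ A := by
    intro γ hγ hγA
    exact hEu' ⟨γu', hγu', rfl, (hAn γu' γ hγ.symm).2 hγA⟩
  have hBw : ∀ γ : SAW.DomainSAW (dom C δ) δ a b, γ.walk.reverse.getVert (m + 1) = w → γ ∈ B := by
    obtain ⟨γ₀, -, h₀, h₀B⟩ := hFw
    exact fun γ hγ => (hBp γ γ₀ (hγ.trans h₀.symm)).2 h₀B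
  have hBw' : ∀ γ : SAW.DomainSAW (dom C δ) δ a b, γ.walk.reverse.getVert (m + 1) = w' → γ ∉ B := by
    intro γ hγ hγB
    exact hFw' ⟨γw', hγw', rfl, (hBp γw' γ hγ.symm).2 hγB⟩
  have huu' : u ≠ u' := fun h => hAu' γu h (hAu γu rfl)
  have hww' : w ≠ w' := fun h => hBw' γw h (hBw γw rfl)
  -- the entries as path kernels
  have hentry : ∀ {v t : Site 2}, v ∉ fixedSet k π m σ → t ∉ fixedSet k π m σ → G.Adj (π k) v → G.Adj t (σ m) →
      (v ∈ s.image fun γ => γ.walk.getVert (k + 1)) → (t ∈ s.image fun γ => γ.walk.reverse.getVert (m + 1)) →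
      ∑ γ ∈ s.filter (fun γ => γ.walk.getVert (k + 1) = v ∧ γ.walk.reverse.getVert (m + 1) = t), x ^ γ.length =
        x ^ (k + m + 2) * (BoundaryTP2.pathKernel H x v t).toReal := by
    intro v t hv ht hpv htq hvs hts
    rw [← sum_dirSet_eq hD h2 hfin hx.le hv ht hpv htq]
    refine sum_congr ?_ fun _ _ => rfl
    obtain ⟨γv, hγv, rfl⟩ := mem_image.1 hvs
    obtain ⟨γt, hγt, rfl⟩ := mem_image.1 hts
    ext γ
    simp only [mem_filter, mem_univ, true_and, mem_dirSet]
    constructor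
    · rintro ⟨hγs, h1, h2⟩
      exact ⟨hs1 γ hγs, h1, h2⟩
    · rintro ⟨hγc, h1, h2⟩
      exact ⟨hs2 γ hγc ⟨γv, hγv, h1.symm⟩ ⟨γt, hγt, h2.symm⟩, h1, h2⟩
  have hxc : 0 ≤ x ^ (k + m + 2) := pow_nonneg hx.le _
  have hK : ∀ v t : Site 2, (BoundaryTP2.pathKernel H x v t).toReal = (BoundaryTP2.pathKernel H x t v).toReal :=
    fun v t => by rw [BoundaryTP2.pathKernel_comm]
  have hne : ∀ v t : Site 2, BoundaryTP2.pathKernel H x v t ≠ ∞ := fun v t => BoundaryTP2.pathKernel_ne_top hfin x v t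
  rw [hentry huf hw'f hpu hw'q hu hw', hentry hu'f hwf hpu' hwq hu' hw, hentry huf hwf hpu hwq hu hw,
    hentry hu'f hw'f hpu' hw'q hu' hw']
  -- it suffices to compare the kernel products
  suffices key : (BoundaryTP2.pathKernel H x u w').toReal * (BoundaryTP2.pathKernel H x u' w).toReal ≤
      (BoundaryTP2.pathKernel H x u w).toReal * (BoundaryTP2.pathKernel H x u' w').toReal by
    have := mul_le_mul_of_nonneg_left key (mul_nonneg hxc hxc)
    nlinarith [this]
  -- neighbour facts in `ℤ²`
  have hzd : G ≤ zdGraph 2 := BoundaryTP2.discreteDomainGraph_le_zdGraph (dom C δ) δ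
  have hun : u ∈ (zdGraph 2).neighborSet (π k) := (mem_neighborSet _ _ _).2 (hzd hpu)
  have hu'n : u' ∈ (zdGraph 2).neighborSet (π k) := (mem_neighborSet _ _ _).2 (hzd hpu')
  have hwn : w ∈ (zdGraph 2).neighborSet (σ m) := (mem_neighborSet _ _ _).2 (hzd hwq).symm
  have hw'n : w' ∈ (zdGraph 2).neighborSet (σ m) := (mem_neighborSet _ _ _).2 (hzd hw'q).symm
  by_cases hinv : r u < r u'
  · -- INVERSION AT THE NEAR END: all `u`-chords meet all `u'`-chords; rows proportional
    have hmeet : ∀ t t' : Site 2, ∀ γ₁ ∈ (dirSet k π m σ u t : Set (SAW.DomainSAW (dom C δ) δ a b)),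
        ∀ γ₂ ∈ dirSet k π m σ u' t', FreeMeet k m γ₁ γ₂ := by
      intro t t' γ₁ h₁ γ₂ h₂
      refine freeMeet_of_inversion hI hr hA h₁.1 h₂.1 (hAu γ₁ h₁.2.1) (hAu' γ₂ h₂.2.1) ?_
      rw [h₁.2.1, h₂.2.1]; exact hinv
    have hall := allMeet_of_freeMeet hD h2 huf hu'f hpu hpu' hmeet
    have heq := hP H hfin u u' {v | v ∉ fixedSet k π m σ ∧ G.Adj v (σ m)} huu' hall w w' ⟨hwf, hwq⟩ ⟨hw'f, hw'q⟩
    have heq' := congrArg ENNReal.toReal heq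
    rw [ENNReal.toReal_mul, ENNReal.toReal_mul] at heq'
    nlinarith [heq']
  by_cases hinv' : r' w < r' w'
  · -- INVERSION AT THE FAR END: columns proportional
    have hmeet : ∀ t t' : Site 2, ∀ γ₁ ∈ (dirSet k π m σ t w : Set (SAW.DomainSAW (dom C δ) δ a b)),
        ∀ γ₂ ∈ dirSet k π m σ t' w', FreeMeet k m γ₁ γ₂ := by
      intro t t' γ₁ h₁ γ₂ h₂
      refine freeMeet_of_inversionR hI hr' hB h₁.1 h₂.1 (hBw γ₁ h₁.2.2) (hBw' γ₂ h₂.2.2) ?_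
      rw [h₁.2.2, h₂.2.2]; exact hinv'
    have hall := allMeet_of_freeMeetR hD h2 hwf hw'f hwq hw'q hmeet
    have heq := hP H hfin w w' {v | v ∉ fixedSet k π m σ ∧ G.Adj (π k) v} hww' hall u u' ⟨huf, hpu⟩ ⟨hu'f, hpu'⟩
    have heq' := congrArg ENNReal.toReal heq
    rw [ENNReal.toReal_mul, ENNReal.toReal_mul] at heq'
    rw [hK u w', hK u' w, hK u w, hK u' w']
    nlinarith [heq']
  -- NORMAL TERM: the crossed chords are incomparable, hence interlaced; `CornerQuadrupleTP2At` signs the minor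
  have hlt : r u' < r u := lt_of_le_of_ne (not_lt.1 hinv) fun h => huu' (hrinj hun hu'n h.symm)
  have hlt' : r' w' < r' w := lt_of_le_of_ne (not_lt.1 hinv') fun h => hww' (hr'inj hwn hw'n h.symm)
  have hmeet : ∀ γ₁ ∈ (dirSet k π m σ u w' : Set (SAW.DomainSAW (dom C δ) δ a b)), ∀ γ₂ ∈ dirSet k π m σ u' w,
      FreeMeet k m γ₁ γ₂ := by
    intro γ₁ h₁ γ₂ h₂
    refine freeMeet_of_crossed hI hr hr' h₁.1 h₂.1 ?_ ?_
    · rw [h₁.2.1, h₂.2.1]; exact hlt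
    · rw [h₁.2.2, h₂.2.2]; exact hlt'
  have hint : BoundaryTP2.Interlaced H u w w' u' :=
    interlaced_of_freeMeet hD h2 huf hu'f hwf hw'f hpu hpu' hwq hw'q hmeet
  have hpq : π k ≠ σ m := marked_ne (hs1 _ hγu) (hnd _ hγu)
  have hfix_p : π k ∈ fixedSet k π m σ := Or.inl ⟨k, le_rfl, rfl⟩
  have hfix_q : σ m ∈ fixedSet k π m σ := Or.inr ⟨m, le_rfl, rfl⟩
  have hineq := hQ H (freeGraph_le k π m σ) hfin (π k) (σ m) u u' w w' hpq (not_mem_support_freeGraph hfix_p)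
    (not_mem_support_freeGraph hfix_q) (hzd hpu) (hzd hpu') (hzd hwq).symm (hzd hw'q).symm huu' hww'
    (fun h => hwf (h ▸ hfix_p)) (fun h => hw'f (h ▸ hfix_p)) (fun h => huf (h ▸ hfix_q))
    (fun h => hu'f (h ▸ hfix_q)) hint
  have := ENNReal.toReal_mono (ENNReal.mul_ne_top (hne _ _) (hne _ _)) hineq
  rw [ENNReal.toReal_mul, ENNReal.toReal_mul] at this
  rw [hK u' w, hK u' w']
  exact this

end Term

end CornerAssembly

/-- REGISTERED SUB-GOAL `stub_cornerAssemblyAux4` of stub `stub_cornerAssembly` (recorded on the crux item so that this file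
lands as a `--supports` proof): the two marked points of a class with a long chord are distinct
(`CornerAssembly.marked_ne`). [folklore] -/
theorem stub_cornerAssemblyAux4 : ∀ {δ : ℝ} {c a b : Site 2} {C : (zdGraph 2).Walk c c} {k : ℕ} {π : ℕ → Site 2} {m : ℕ}
    {σ : ℕ → Site 2} {γ : SAW.DomainSAW (dom C δ) δ a b}, γ ∈ cls k π m σ → k + m + 2 ≤ γ.length → π k ≠ σ m :=
  fun hγ hL => CornerAssembly.marked_ne hγ hL

end Summit.CriticalPhenomena.SAWScalingLimit.Theorems.LeftRightFKG.CornerLoc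

end
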